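import Summits.ValiantsHypothesis.ValiantsHypothesis.Theorems.KPlusLogSqLawTropicalBStaticFourConds
import Summits.ValiantsHypothesis.ValiantsHypothesis.Theorems.KPlusLogSqLawTropicalBStaticFourCoverSound
import Summits.ValiantsHypothesis.ValiantsHypothesis.Theorems.KPlusLogSqLawTropicalBStaticFourSeventeen
import Summits.ValiantsHypothesis.ValiantsHypothesis.Theorems.KPlusLogSqLawTropicalBRelabel
import Summits.ValiantsHypothesis.ValiantsHypothesis.Theorems.KPlusLogSqLawTropicalBTranspose

/-!
# Route `KPlusLogSqLaw`, crux `TropicalB` — THE STATIC `4 × 4` CELL IS EXACTLY `15`: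
# a static `4 × 4` design has at most `15` dominant terms (and `15` is attained)

HONEST FRAMING.  Helper file toward the registered stubs of `Cruxes/TropicalB/Lines/birth.lean` (crux
`Summit.ValiantsHypothesis.ValiantsHypothesis.Theses.KPlusLogSqLaw.TropicalB`, ledger item `stmt-ValiantsHypothesis-19771`, route
`KPlusLogSqLaw`; cell `pub-symmetroid`, seat `val-sym-trop-p4` g7, 2026-08-27).  ONE finite census cell of the STATIC tropical census — integer
parametric ASSIGNMENT instances of size `4`, i.e. affine lines through the normal fan of the Birkhoff polytope `B₄`: **an affine line meets at
most `15` of its `24` chambers**, and `15` is attained (`StaticHalving.static_four_unsigned_fifteen`, p515185); static halving gives `18`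
(`StaticHalving.static_row_four`), the quad transversal count `17` (`StaticFourQuad.static_row_four_sixteen`, p520468).  Nothing here bears on
`TropicalB` in its window, `WeakLifting`, DoorA26/DoorA34, `MatrixDescartes` (stmt-18050) or `VP ≠ VNP`.

THE ASSEMBLY (this file) of the pieces landed by this seat:
* `16` dominant permutations of a static `4 × 4` design contain no parallelogram quad (exchange-square law, p493290), so by the ORBIT COVER
  (`cover`, `…StaticFourCoverSound`: kernel enumeration of the `5 328` quad-free `16`-subsets of `S₄` with certificates) a row relabelling `π`,
  a column relabelling `ρ` and possibly a transposition carry them onto one of `14` representatives `repT r`;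
* the relabelled / transposed design is static and carries the transported dominant terms (`…TropicalBRelabel`, `…TropicalBTranspose`);
* by the INTERPRETATION (`conds_hold`, `…StaticFourConds`: diagonal bracketing and the `3 × 3` parity-class law, p522470, plus the `decide`d
  cell identities) its `36` block exchanges satisfy the triple laws and every condition of `condsOf (repT r)`;
* which the SIGN CHECKER refutes (`rep_contradiction`, `…StaticFourSignChecker`: `14` kernel runs).
Results: `StaticFourQuad.static_row_four_fourteen : IsStatic ε → DesignRowD d v ε 14`; `tropRootLawAtStatic_four_fourteen (K) :
TropRootLawAtStatic 4 K 14`; `static_four_cell_exact` (the unsigned cell is `15` exactly; signed `13 ≤ · ≤ 15`).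
[this seat]
-/

set_option linter.dupNamespace false
set_option autoImplicit false

namespace Summit.ValiantsHypothesis.ValiantsHypothesis.Theorems.KPlusLogSqLaw.StaticFourQuad

open Summit.ValiantsHypothesis.ValiantsHypothesis.Theorems.MatrixDescartes.Negative
open Summit.ValiantsHypothesis.ValiantsHypothesis.Theorems.LacunarySymmetroidMatrixDescartes
open Summit.ValiantsHypothesis.ValiantsHypothesis.Theorems.LacunarySymmetroidMatrixDescartes.TropicalCensus
open Finset

/-- the corner structure of the quads of `quadT`: right multiplication by two disjoint column transpositions. -/
theorem quadT_perm : ∀ q ∈ quadT, ∃ a b c e : Fin 4, a ≠ b ∧ c ≠ e ∧ a ≠ c ∧ a ≠ e ∧ b ≠ c ∧ b ≠ e ∧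
    (∀ i : Fin 4, i ≠ a → i ≠ b → Equiv.swap c e i ≠ a ∧ Equiv.swap c e i ≠ b) ∧
    P24 q.2.1 = P24 q.1 * Equiv.swap a b ∧ P24 q.2.2.1 = P24 q.1 * Equiv.swap c e ∧
    P24 q.2.2.2 = P24 q.1 * Equiv.swap a b * Equiv.swap c e := by
  decide +kernel

/-- every permutation of `Fin 4` is in the table. -/
theorem P24_surj' : ∀ σ : Equiv.Perm (Fin 4), ∃ i : Fin 24, P24 i = σ := by decide

section Transport

variable {K : ℕ} (d : Fin K → ℕ) (v ε : Fin 4 → Fin 4 → Fin K → ℤ) (πp ρp : Equiv.Perm (Fin 4))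

/-- the relabelled design is static if the design is. -/
theorem isStatic_relabel (hs : IsStatic ε) : IsStatic (fun a b l => ε (πp a) (ρp b) l) :=
  fun _ _ _ _ h h' => hs _ _ _ _ h h'

/-- the transposed design is static if the design is. -/
theorem isStatic_transpose (hs : IsStatic ε) : IsStatic (fun a b l => ε b a l) :=
  fun _ _ _ _ h h' => hs _ _ _ _ h h'

/-- transport of a term to the relabelled design: permutation `π⁻¹ σ ρ`. -/
def relabT (q : Equiv.Perm (Fin 4) × (Fin 4 → Fin K)) : Equiv.Perm (Fin 4) × (Fin 4 → Fin K) :=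
  (πp⁻¹ * q.1 * ρp, fun j => q.2 (ρp j))

/-- transport of a term to the transposed design: permutation `σ⁻¹`. -/
def transpT (q : Equiv.Perm (Fin 4) × (Fin 4 → Fin K)) : Equiv.Perm (Fin 4) × (Fin 4 → Fin K) :=
  (q.1⁻¹, fun j => q.2 (q.1⁻¹ j))

/-- a dominant term stays dominant in the relabelled design (as `relabT`). -/
theorem isDominant_relabT {θ : ℤ} {q : Equiv.Perm (Fin 4) × (Fin 4 → Fin K)} (h : IsDominant d v ε θ q) :
    IsDominant d (fun a b l => v (πp a) (ρp b) l) (fun a b l => ε (πp a) (ρp b) l) θ (relabT πp ρp q) := by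
  rw [← isDominant_relabel_iff d v ε πp ρp (relabT πp ρp q) θ]
  have e : ((πp * (relabT πp ρp q).1 * ρp⁻¹ : Equiv.Perm (Fin 4)), fun j => (relabT πp ρp q).2 (ρp⁻¹ j)) = q := by
    refine Prod.ext ?_ (funext fun j => ?_)
    · show πp * (πp⁻¹ * q.1 * ρp) * ρp⁻¹ = q.1
      group
    · show q.2 (ρp (ρp⁻¹ j)) = q.2 j
      simp
  rw [e]; exact h

/-- a dominant term stays dominant in the transposed design (as `transpT`). -/
theorem isDominant_transpT {θ : ℤ} {q : Equiv.Perm (Fin 4) × (Fin 4 → Fin K)} (h : IsDominant d v ε θ q) :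
    IsDominant d (fun a b l => v b a l) (fun a b l => ε b a l) θ (transpT q) := by
  rw [← isDominant_transpose_iff d v ε (transpT q) θ]
  have e : (((transpT q).1⁻¹ : Equiv.Perm (Fin 4)), fun j => (transpT q).2 ((transpT q).1⁻¹ j)) = q := by
    refine Prod.ext ?_ (funext fun j => ?_)
    · show (q.1⁻¹)⁻¹ = q.1
      simp
    · show q.2 (q.1⁻¹ ((q.1⁻¹)⁻¹ j)) = q.2 j
      simp
  rw [e]; exact h

end Transport

/-- **THE STATIC `4 × 4` CELL, upper bound: a static `4 × 4` design has at most `15` dominant terms** (`DesignRowD d v ε 14`, every `K`). -/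
theorem static_row_four_fourteen {K : ℕ} (d : Fin K → ℕ) (v ε : Fin 4 → Fin 4 → Fin K → ℤ) (hs : IsStatic ε) :
    DesignRowD d v ε 14 := by
  classical
  intro n θ p hθ hdom hne
  by_contra hn
  push Not at hn
  have hinj := injective_of_chainD d v ε θ p hθ hdom hne
  -- classes are determined by rows (static), so the chain's permutations are pairwise different
  have hcl : ∀ (a b : Fin (n + 1)) (i : Fin 4), (p a).1 i = (p b).1 i → (p a).2 i = (p b).2 i := by
    intro a b i hab
    have ha := present_of_termSign_ne_zero ε (p a) (hdom a).1 i
    have hb := present_of_termSign_ne_zero ε (p b) (hdom b).1 i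
    rw [hab] at ha
    exact hs _ _ _ _ ha hb
  have hperm : ∀ a b : Fin (n + 1), (p a).1 = (p b).1 → p a = p b := fun a b hab =>
    ExchangeSquare.term_eq_of_agree fun i => ⟨by rw [hab], hcl a b i (by rw [hab])⟩
  -- indices of the chain's permutations
  let code : Equiv.Perm (Fin 4) → Fin 24 := fun σ => Fin.find (fun i => P24 i = σ) (P24_surj' σ)
  have P24_code : ∀ σ, P24 (code σ) = σ := fun σ => Fin.find_spec (p := fun i => P24 i = σ) (P24_surj' σ)
  let f : Fin (n + 1) → Fin 24 := fun k => code (p k).1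
  have hfP : ∀ k, P24 (f k) = (p k).1 := fun k => P24_code _
  have hf : Function.Injective f := by
    intro a b hab
    apply hinj; apply hperm
    rw [← hfP a, ← hfP b]
    exact congrArg P24 hab
  set S : Finset (Fin 24) := (univ : Finset (Fin (n + 1))).image f with hSdef
  have hScard : 16 ≤ #S := by rw [card_image_of_injective _ hf, card_univ, Fintype.card_fin]; omega
  have hSmem : ∀ s ∈ S, ∃ k, (p k).1 = P24 s := by
    intro s hs'
    obtain ⟨k, -, hk⟩ := mem_image.1 hs'
    exact ⟨k, by rw [← hk, hfP]⟩
  -- no full quad among dominant permutations (exchange-square law)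
  have hnoquad : ∀ q ∈ quadT, ¬ (q.1 ∈ S ∧ q.2.1 ∈ S ∧ q.2.2.1 ∈ S ∧ q.2.2.2 ∈ S) := by
    rintro q hq ⟨m0, m1, m2, m3⟩
    obtain ⟨k0, h0⟩ := hSmem _ m0
    obtain ⟨k1, h1⟩ := hSmem _ m1
    obtain ⟨k2, h2⟩ := hSmem _ m2
    obtain ⟨k3, h3⟩ := hSmem _ m3
    obtain ⟨a, b, c, e, hab, hce, hac, hae, hbc, hbe, hswap, q1, q2, q3⟩ := quadT_perm q hq
    have e1 : (p k1).1 = (p k0).1 * Equiv.swap a b := by rw [h1, q1, h0]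
    have e2 : (p k2).1 = (p k0).1 * Equiv.swap c e := by rw [h2, q2, h0]
    have e3 : (p k3).1 = (p k0).1 * Equiv.swap a b * Equiv.swap c e := by rw [h3, q3, h0]
    have hne02 : p k0 ≠ p k2 := by
      intro hh
      have h' : (p k0).1 = (p k0).1 * Equiv.swap c e := by rw [← e2, hh]
      have : Equiv.swap c e = 1 := by
        have := congrArg (fun x => (p k0).1⁻¹ * x) h'
        simpa using this.symm
      exact hce (Equiv.swap_eq_one_iff.1 this)
    have hne01 : p k0 ≠ p k1 := by
      intro hh
      have h' : (p k0).1 = (p k0).1 * Equiv.swap a b := by rw [← e1, hh]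
      have : Equiv.swap a b = 1 := by
        have := congrArg (fun x => (p k0).1⁻¹ * x) h'
        simpa using this.symm
      exact hab (Equiv.swap_eq_one_iff.1 this)
    have hmem : ∀ i : Fin 4, i ∈ ({a, b} : Finset (Fin 4)) ↔ i = a ∨ i = b := fun i => by
      rw [mem_insert, mem_singleton]
    refine ExchangeSquare.not_dominant_split_square d v ε ({a, b} : Finset (Fin 4))
      (p₁₁ := p k0) (p₁₂ := p k2) (p₂₁ := p k1) (p₂₂ := p k3) ?_ ?_ ?_ ?_ hne02 hne01
      (hdom k0) (hdom k2) (hdom k1) (hdom k3)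
    · intro i hi
      have hia : i ≠ c ∧ i ≠ e := by
        rcases (hmem i).1 hi with rfl | rfl
        · exact ⟨hac, hae⟩
        · exact ⟨hbc, hbe⟩
      have hrow : (p k0).1 i = (p k2).1 i := by
        rw [e2, Equiv.Perm.mul_apply, Equiv.swap_apply_of_ne_of_ne hia.1 hia.2]
      exact ⟨hrow, hcl _ _ _ hrow⟩
    · intro i hi
      have hia : i ≠ c ∧ i ≠ e := by
        rcases (hmem i).1 hi with rfl | rfl
        · exact ⟨hac, hae⟩
        · exact ⟨hbc, hbe⟩
      have hrow : (p k1).1 i = (p k3).1 i := by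
        rw [e1, e3]
        simp only [Equiv.Perm.mul_apply]
        rw [Equiv.swap_apply_of_ne_of_ne hia.1 hia.2]
      exact ⟨hrow, hcl _ _ _ hrow⟩
    · intro i hi
      have hi' : i ≠ a ∧ i ≠ b := by
        constructor <;> (intro he'; exact hi ((hmem i).2 (by simp [he'])))
      have hrow : (p k0).1 i = (p k1).1 i := by
        rw [e1, Equiv.Perm.mul_apply, Equiv.swap_apply_of_ne_of_ne hi'.1 hi'.2]
      exact ⟨hrow, hcl _ _ _ hrow⟩
    · intro i hi
      have hi' : i ≠ a ∧ i ≠ b := by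
        constructor <;> (intro he'; exact hi ((hmem i).2 (by simp [he'])))
      have hsw := hswap i hi'.1 hi'.2
      have hrow : (p k2).1 i = (p k3).1 i := by
        rw [e2, e3]
        simp only [Equiv.Perm.mul_apply]
        rw [Equiv.swap_apply_of_ne_of_ne hsw.1 hsw.2]
      exact ⟨hrow, hcl _ _ _ hrow⟩
  -- a quad-free 16-subset and its cover
  obtain ⟨V, hVS, hVcard⟩ := Finset.exists_subset_card_eq hScard
  have hVq : ∀ q ∈ quadT, ¬ (q.1 ∈ V ∧ q.2.1 ∈ V ∧ q.2.2.1 ∈ V ∧ q.2.2.2 ∈ V) :=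
    fun q hq h => hnoquad q hq ⟨hVS h.1, hVS h.2.1, hVS h.2.2.1, hVS h.2.2.2⟩
  obtain ⟨π, ρ, τ, r, hrep⟩ := cover V hVcard hVq
  set πp := P24 π
  set ρp := P24 ρ
  -- the transported family of dominant terms and its permutations
  have key : ∀ s' : Fin 24, repT r s' = true → ∃ k, ((if τ then transpT (relabT πp ρp (p k)) else relabT πp ρp (p k)).1 = P24 s') := by
    intro s' hs'
    obtain ⟨s, hsV, hact⟩ := (hrep s').1 hs'
    obtain ⟨k, hk⟩ := hSmem s (hVS hsV)
    refine ⟨k, ?_⟩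
    obtain ⟨t₁, ht₁, hP₁⟩ := LT_spec π s
    obtain ⟨t₂, ht₂, hP₂⟩ := RT_spec ρ t₁
    have hrel : (relabT πp ρp (p k)).1 = P24 t₂ := by
      show πp⁻¹ * (p k).1 * ρp = P24 t₂
      rw [hP₂, hP₁, hk]
    cases τ with
    | false =>
      simp only [Bool.false_eq_true, if_false]
      rw [hrel]
      congr 1
      apply Fin.ext
      rw [ht₂, ht₁, ← hact]
      rfl
    | true =>
      simp only [if_true]
      obtain ⟨t₃, ht₃, hP₃⟩ := IT_spec t₂
      show ((relabT πp ρp (p k)).1)⁻¹ = P24 s'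
      rw [hrel, ← hP₃]
      congr 1
      apply Fin.ext
      rw [ht₃, ht₂, ht₁, ← hact]
      rfl
  -- the transported design and the contradiction
  cases τ with
  | false =>
    obtain ⟨ee, hT, hconds⟩ := conds_hold d (fun a b l => v (πp a) (ρp b) l) (isStatic_relabel ε πp ρp hs) θ
      (fun k => relabT πp ρp (p k)) (fun k => isDominant_relabT d v ε πp ρp (hdom k)) (repT r)
      (fun s' hs' => by simpa using key s' hs')
    exact rep_contradiction r hT hconds
  | true =>
    obtain ⟨ee, hT, hconds⟩ := conds_hold d (fun a b l => v (πp b) (ρp a) l)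
      (isStatic_transpose _ (isStatic_relabel ε πp ρp hs)) θ
      (fun k => transpT (relabT πp ρp (p k)))
      (fun k => isDominant_transpT d _ _ (isDominant_relabT d v ε πp ρp (hdom k))) (repT r)
      (fun s' hs' => by simpa using key s' hs')
    exact rep_contradiction r hT hconds

/-- **The static size-`4` tropical row is at most `14` breakpoints (`15` terms) for every `K`.** -/
theorem tropRootLawAtStatic_four_fourteen (K : ℕ) : TropRootLawAtStatic 4 K 14 :=
  fun d v ε _ θ p _ hs hθ hdom halt => le_of_designRowD (static_row_four_fourteen d v ε hs) θ p hθ hdom halt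

/-- **THE STATIC `4 × 4` CELL IS EXACTLY `15` (unsigned)**: every static `4 × 4` design satisfies `DesignRowD … 14`, and the explicit design
of `StaticHalving.static_four_unsigned_fifteen` violates `DesignRowD … 13`. -/
theorem static_four_cell_exact :
    (∀ (K : ℕ) (d : Fin K → ℕ) (v ε : Fin 4 → Fin 4 → Fin K → ℤ), IsStatic ε → DesignRowD d v ε 14) ∧
    (∃ (d : Fin 16 → ℕ) (v ε : Fin 4 → Fin 4 → Fin 16 → ℤ), IsStatic ε ∧ (∀ i j l, (ε i j l).natAbs ≤ 1) ∧ ¬ DesignRowD d v ε 13) :=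
  ⟨fun _ d v ε hs => static_row_four_fourteen d v ε hs, StaticHalving.static_four_unsigned_fifteen⟩

/-- **the signed static size-`4` cell**: `TropRootLawAtStatic 4 16 14 ∧ ¬ TropRootLawAtStatic 4 16 11` (`13 ≤ · ≤ 15` alternating terms). -/
theorem static_four_cell_signed : TropRootLawAtStatic 4 16 14 ∧ ¬ TropRootLawAtStatic 4 16 11 :=
  ⟨tropRootLawAtStatic_four_fourteen 16, fun h => absurd (StaticHalving.static_four_signed_thirteen h) (by norm_num)⟩

end Summit.ValiantsHypothesis.ValiantsHypothesis.Theorems.KPlusLogSqLaw.StaticFourQuad
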